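import Summits.ABC.StewartYu.ArchG3StartRec
import Summits.ABC.StewartYu.ArchG3RecSiegel
import HarnessLib

/-!
# Cell abc-stewartyu, rung A1.L (crux r2 `ArchCoreRat`), WP-L.A: the START at `S(θ)` on the record of reference WITH THE SIEGEL LINE
# DISCHARGED — no numeric hypothesis left

`Summits/ABC/StewartYu/ArchG3StartClosed.lean` — cell `abc-stewartyu` (HOME `run/shared/lean/pub/abc-stewartyu/`; seat lp-1 g8).  One theorem:
`archLevelStateQ_zero_closed` = `ArchG3StartRec.archLevelStateQ_zero_rec` with its hypothesis (L1) supplied by `ArchG3RecSiegel.siegel_line`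
through the index identity `|det C| = N` (`SatKitD`, seat p1/p2's L-INDEX) and `P.N = F.N`.  What remains for `stub_startArch` is record
LETTER work only: the bound `log P ≤ log((L₀+1)·∏(2Bv+2)) + log AmaxR` and the packages (seats p1/p5).

WHAT THIS IS NOT: the packages; no crux moves.

References: Yu. V. Nesterenko, LNM 1819 (2003) §3.3 Prop. 3.4, §3.5 (3.22)–(3.30) Prop. 3.9, §4 (4.6), p. 66–81 [Nesterenko2003].
-/

noncomputable section

open Finset
open scoped Matrix

namespace Summit.ABC.StewartYu

namespace ArchG3Setup

variable {S : ArchG3Setup}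

/-- **THE START AT `S(θ)` ON THE RECORD OF REFERENCE, hypothesis-free up to letters**: `P.N = F.N`, `|det C| = N` (index identity),
`|log α°ⱼ| ≤ Aⱼ`, a Δ-basis `(cl, el)` with `cl 0 ≠ 0`, `el 0 j₀ = 0` ⇒ the level-`0` state `ArchLevelStateQ (VBoxQ ν LνR) …` on some
`unkA L₀ 𝔏` with `#unkA ≤ (L₀+1)·∏(LνR 0 j + 1)` and Siegel height `⌈#unkA·AmaxR⌉`.
[cite: Nesterenko2003, §3.3 Prop. 3.4, §3.5 (3.22)–(3.30) Prop. 3.9, §4 (4.6), p. 66–81] -/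
theorem archLevelStateQ_zero_closed (F : S.SatData) (P : ArchG3Rec S.n) (hNF : P.N = F.N) (hdet : F.C.det.natAbs = F.N)
    (hAo : ∀ j, |Real.log (F.αo j : ℝ)| ≤ P.A j)
    (cl : ℕ → ℤ) (el : ℕ → Fin S.n → ℤ) (hc : cl 0 ≠ 0) (he : el 0 S.j₀ = 0) :
    ∃ (𝔏 : Finset (Fin S.n → ℤ)) (pv : ℕ × (Fin S.n → ℤ) → ℤ), (∀ i ∈ S.unkA P.L₀ 𝔏, i.1 ≤ P.L₀) ∧
      (S.unkA P.L₀ 𝔏).card ≤ (P.L₀ + 1) * ∏ j, (S.LνR P 0 j + 1) ∧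
      S.ArchLevelStateQ (S.VBoxQ (Matrix.vecMulLinear F.U).toAddMonoidHom (S.LνR P)) P.H P.Sd (S.sθR F P) (S.unkA P.L₀ 𝔏) pv
        ⌈((S.unkA P.L₀ 𝔏).card : ℝ) * S.AmaxR F P (cl 0) (el 0)⌉ P.wl P.γb cl el 0 (P.Nf 0 0) (P.Tf 0 0) := by
  refine S.archLevelStateQ_zero_rec F P hNF hAo cl el hc he ?_
  have h := P.siegel_line
  rw [hdet, ← hNF]
  exact h

end ArchG3Setup

end Summit.ABC.StewartYu

end
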